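import Summits.FinalStateConjecture.FinalStateConjecture.Theses.ZeroEnergyKerrOrBomb
import Literature.Geometry.Lorentzian.TrivialDataAdmissible

/-!
# Crux `StationaryLimitReduction` (stmt-FinalStateConjecture-10021) — negative-side support:
# what a refutation must contain (cdisprove seat, cycle 1)

The crux of route `ZeroEnergyKerrOrBomb` reads `StationaryLimitReduction := KerrOrBomb →
FinalStateConjecture`. This file records, kernel-checked and sorry-free, the shape of any
refutation of it and of the summit it reduces to:

* `not_stationaryLimitReduction_iff` — `¬ StationaryLimitReduction ↔ KerrOrBomb ∧
  ¬ FinalStateConjecture`: a disproof of the crux is a PROOF of the route's target (smooth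
  stationary vacuum rigidity of Killing-mode-stable holes) together with a REFUTATION of the summit;
* `not_finalStateConjecture_of_forall_not` — since Christodoulou-genericity only asks for an
  admissible curve of good data through each bad datum, the summit is refuted as soon as, on ONE
  slice carrying an admissible datum, the summit property fails for EVERY admissible datum (a
  genericity family through the bad datum consists of admissible, hence bad, data);
* `not_finalStateConjecture_of_forall_not_slice` — the same on the Minkowski slice `ℝ³`, which
  carries the proved-admissible trivial data (`trivialData_mem_admissibleVacuumData`);
* `not_stationaryLimitReduction_of` — hence the only kill of the crux conceivable in the present
  tree (no individual maximal Cauchy development is constructible): the target plus a uniform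
  failure of the summit property on `admissibleVacuumData Minkowski.slice`.

Neither input is available (the target is open; the summit property is expected to HOLD for the
trivial data, `N = 0` dispersal), which is why the crux resists: in every plausible world it is
equivalent to the summit itself. No definition is introduced; the summit property is written out
verbatim from `Summits/FinalStateConjecture/FinalStateConjecture/Statement.lean`.
-/

noncomputable section

open scoped Manifold ContDiff

-- `Summit.FinalStateConjecture.FinalStateConjecture.…` is the tree's mandated namespace (summit = sub-problem).
set_option linter.dupNamespace false

namespace Summit.FinalStateConjecture.FinalStateConjecture.Theorems.StationaryLimitReduction.Negative

open Summit.FinalStateConjecture.FinalStateConjecture.Theses.ZeroEnergyKerrOrBomb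
open Literature.Geometry.Lorentzian

/-- **Shape of a refutation of the crux.** `StationaryLimitReduction` is the implication
`KerrOrBomb → FinalStateConjecture`, so its negation is exactly: the route's target holds AND the
summit statement fails. -/
theorem not_stationaryLimitReduction_iff :
    ¬ StationaryLimitReduction ↔ (KerrOrBomb ∧ ¬ _root_.FinalStateConjecture) :=
  Classical.not_imp

/-- **Uniform failure of the summit property on one admissible slice refutes the summit.** If `X`
carries an admissible datum `D` and the summit property (an MGHD exists; every MGHD has complete
`𝓘⁺` and an exhaustive sub-extremal Kerr final-state decomposition of its self-determined exterior)
fails for every admissible datum on `X`, then `FinalStateConjecture` is false: the codimension-`1`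
genericity clause would give a smooth injective admissible one-parameter family through `D` whose
nonzero-parameter members satisfy the property. -/
theorem not_finalStateConjecture_of_forall_not {X : Type} [TopologicalSpace X] [ChartedSpace E3 X]
    [IsManifold (𝓡 3) ∞ X] [T2Space X] [SecondCountableTopology X] [ConnectedSpace X]
    {D : InitialDataSet (𝓡 3) X} (hD : D ∈ admissibleVacuumData X)
    (h : ∀ D' ∈ admissibleVacuumData X,
      ¬ ((∃ 𝒟 : VacuumCauchyDevelopment D', 𝒟.IsMaximal) ∧
        ∀ 𝒟 : VacuumCauchyDevelopment D', 𝒟.IsMaximal →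
          Summit.FinalStateConjecture.HasCompleteNullInfinity 𝒟.toCauchyDevelopment ∧
            ∃ (O : Set 𝒟.carrier) (d : FinalStateDecomposition 𝒟.toSpacetime O 2),
              (∀ i, Kerr.IsSubextremal (d.mass i) (d.spin i)) ∧
                O = Summit.FinalStateConjecture.exteriorOf 𝒟.toCauchyDevelopment d.charted ∧
                  Summit.FinalStateConjecture.HasExhaustiveCharts d)) :
    ¬ _root_.FinalStateConjecture := by
  intro hF
  -- buildfix 2026-08-20 (proof-only): since the T2 re-type (2026-08-16) the summit is TAME
  -- Christodoulou genericity of a property with two more conjuncts (`RaysStayInClosure`,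
  -- `IsFutureOriented`); that property implies the one spelled in `h`, so `h` still makes every
  -- admissible datum exceptional, and the tame family through `D` is in particular a family of
  -- admissible data meeting the exceptional set only at `c = 0`.
  have hweak : ∀ D' ∈ admissibleVacuumData X,
      ¬ ((∃ 𝒟 : VacuumCauchyDevelopment D', 𝒟.IsMaximal) ∧
        ∀ 𝒟 : VacuumCauchyDevelopment D', 𝒟.IsMaximal →
          Summit.FinalStateConjecture.HasCompleteNullInfinity 𝒟.toCauchyDevelopment ∧
            ∃ (O : Set 𝒟.carrier) (d : FinalStateDecomposition 𝒟.toSpacetime O 2),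
              (∀ i, Kerr.IsSubextremal (d.mass i) (d.spin i)) ∧
                O = Summit.FinalStateConjecture.exteriorOf 𝒟.toCauchyDevelopment d.charted ∧
                  Summit.FinalStateConjecture.RaysStayInClosure 𝒟.toCauchyDevelopment O ∧
                    Summit.FinalStateConjecture.HasExhaustiveCharts d ∧
                      Summit.FinalStateConjecture.IsFutureOriented d) := by
    rintro D' hD' ⟨hex, hall⟩
    refine h D' hD' ⟨hex, fun 𝒟 h𝒟 ↦ ?_⟩
    obtain ⟨hscri, O, d, hsub, hO, -, hexh, -⟩ := hall 𝒟 h𝒟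
    exact ⟨hscri, O, d, hsub, hO, hexh⟩
  obtain ⟨-, F, -, -, -, -, hF𝓓, hgood⟩ := hF X D ⟨hD, hweak D hD⟩
  have hc : (EuclideanSpace.single 0 1 : EuclideanSpace ℝ (Fin 1)) ≠ 0 := fun h0 ↦ by
    simpa using congrArg (fun v : EuclideanSpace ℝ (Fin 1) ↦ v 0) h0
  exact hgood _ hc ⟨hF𝓓 _, hweak _ (hF𝓓 _)⟩

/-- **The Minkowski slice suffices.** `ℝ³ = Minkowski.slice` carries the admissible trivial data
(`trivialData_mem_admissibleVacuumData`), so a uniform failure of the summit property on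
`admissibleVacuumData Minkowski.slice` refutes `FinalStateConjecture`. (Expected NOT to occur:
for the trivial data the property is `N = 0` dispersal of Minkowski space.) -/
theorem not_finalStateConjecture_of_forall_not_slice
    (h : ∀ D' ∈ admissibleVacuumData Minkowski.slice,
      ¬ ((∃ 𝒟 : VacuumCauchyDevelopment D', 𝒟.IsMaximal) ∧
        ∀ 𝒟 : VacuumCauchyDevelopment D', 𝒟.IsMaximal →
          Summit.FinalStateConjecture.HasCompleteNullInfinity 𝒟.toCauchyDevelopment ∧
            ∃ (O : Set 𝒟.carrier) (d : FinalStateDecomposition 𝒟.toSpacetime O 2),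
              (∀ i, Kerr.IsSubextremal (d.mass i) (d.spin i)) ∧
                O = Summit.FinalStateConjecture.exteriorOf 𝒟.toCauchyDevelopment d.charted ∧
                  Summit.FinalStateConjecture.HasExhaustiveCharts d)) :
    ¬ _root_.FinalStateConjecture :=
  not_finalStateConjecture_of_forall_not trivialData_mem_admissibleVacuumData h

/-- **The only kill of the crux conceivable in this tree**: a proof of the target `KerrOrBomb`
together with a uniform failure of the summit property on the Minkowski slice. Recorded so that
the lead sees what a refutation of `StationaryLimitReduction` would have to contain; both inputs
are out of reach. -/
theorem not_stationaryLimitReduction_of (hX : KerrOrBomb)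
    (h : ∀ D' ∈ admissibleVacuumData Minkowski.slice,
      ¬ ((∃ 𝒟 : VacuumCauchyDevelopment D', 𝒟.IsMaximal) ∧
        ∀ 𝒟 : VacuumCauchyDevelopment D', 𝒟.IsMaximal →
          Summit.FinalStateConjecture.HasCompleteNullInfinity 𝒟.toCauchyDevelopment ∧
            ∃ (O : Set 𝒟.carrier) (d : FinalStateDecomposition 𝒟.toSpacetime O 2),
              (∀ i, Kerr.IsSubextremal (d.mass i) (d.spin i)) ∧
                O = Summit.FinalStateConjecture.exteriorOf 𝒟.toCauchyDevelopment d.charted ∧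
                  Summit.FinalStateConjecture.HasExhaustiveCharts d)) :
    ¬ StationaryLimitReduction :=
  not_stationaryLimitReduction_iff.2 ⟨hX, not_finalStateConjecture_of_forall_not_slice h⟩

end Summit.FinalStateConjecture.FinalStateConjecture.Theorems.StationaryLimitReduction.Negative

end
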